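import Summits.QuantumFields.YangMills.Theorems.F4SubCurvatureDoorSubCurvatureKernelExtraction
import Summits.QuantumFields.YangMills.Theorems.F4SubCurvatureDoorSubCurvatureKernelTranslationRung
import HarnessLib

/-!
# Route `F4SubCurvatureDoor`, crux `SubCurvatureKernel` ⟨stmt-QuantumFields-23036⟩ — the KERNEL RUNG:
# every off-diagonal limit point of the legs has a bounded measurable two-point KERNEL off the diagonal

Helper file (`--supports stmt-QuantumFields-23036 --as helper`; free-hands seat `ym-line-frs-p2` g17, clause (K) of the soft-half scope, HOME INBOX
2026-08-29T16:34:27Z / 16:47:40Z).  Definition-free, 0 sorry, standard axioms.  No item is closed; no summit, no crux and no mass gap is proved by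
this file.

WHAT.  `exists_kernel_of_offDiagLimitAlong`: under `MomentBounds6 G r a` (positive unit map `a → 0`), along every admissible leg scheme and every
subsequence `φ → ∞`, for every off-diagonal limit point `S₁` (`OffDiagLimitAlong r sch φ S₁`) and every separation `δ > 0` there is a bounded
measurable kernel `K : ℝ⁴ → ℂ` with `S₁ 2 F = ∫ K(x₀ − x₁) F(x) dx` for every compactly supported test function supported in `Separated 2 δ` —
the REPRESENTATION CLAUSE of `SubCurvatureKernel` (route file :338ff, clause 6) away from the diagonal.  Inputs: translation invariance of leg-scheme
limit points (✓p733041 `translate_invariant_of_offDiagLimitAlong`), the density clause of `OffDiagLimitAlong`, and the kernel-generic extraction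
✓`exists_kernel_of_translate_invariant` (cutoff/weight + `L¹` extension + LEAD sfw-p2 g76's Rudin-6.16 density + fibre averaging).  Crux-prefix form:
`subCurvatureKernel_rung_kernel`.

HONEST LABEL: the representation is proved OFF every `δ`-collar of the diagonal with a `δ`-dependent kernel bound (the kernels for different `δ` agree
a.e. where both apply, by uniqueness of densities — not restated here); the extension to ALL compactly supported off-diagonal test functions (supports
touching the diagonal) needs the quantitative `δ⁻⁸` growth of the density constant, CONTINUITY of `K` off `0` is clause (C), reflection positivity of
the kernel follows from ✓p733252 once (C) holds, King faithfulness is ✓p733727 — and the SUB-CURVATURE clause (asymptotic freedom) is the crux, untouched.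
⟨23036⟩ is an open problem; the Yang–Mills mass gap is NOT proved; no summit is proved by a line.
-/

set_option autoImplicit false

noncomputable section

open scoped SchwartzMap BigOperators
open MeasureTheory Filter Topology Set
open Literature.MathematicalPhysics.QuantumFieldTheory Literature.MathematicalPhysics.QuantumLattice
open Literature.MathematicalPhysics.AQFT
open Summit.QuantumFields.YangMills.Cruxes.OSLegsFromFemtoAndGap.DlrCollarTransfer (MomentBounds6)
open Summit.QuantumFields.YangMills.Cruxes.OSLegsAtWeakCouplingC.Sketch (Separated OffDiagDensity)
open Summit.QuantumFields.YangMills.Theorems.ROT (IsLegScheme OffDiagLimitAlong)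
open Summit.QuantumFields.YangMills.Theorems.NPointIsotropy.Negative (E4)
open Summit.QuantumFields.YangMills.Theorems.F4SubCurvatureDoorSubCurvatureKernelExtraction (exists_kernel_of_translate_invariant)
open Summit.QuantumFields.YangMills.Theorems.F4SubCurvatureDoorSubCurvatureKernelTranslation (translate_invariant_of_offDiagLimitAlong)

namespace Summit.QuantumFields.YangMills.Theorems.F4SubCurvatureDoorSubCurvatureKernelLeg

variable {G : Type} [Group G] [TopologicalSpace G] [IsTopologicalGroup G] [CompactSpace G]
  [MeasurableSpace G] [BorelSpace G]

/-- ★ **THE KERNEL RUNG.**  Every off-diagonal limit point of the legs (under `MomentBounds6`) has, off every `δ`-collar of the diagonal, a bounded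
measurable two-point kernel of the difference variable representing its two-point distribution on compactly supported test functions.
[cite: OS1973, §2] [cite: GlimmJaffe1987, §6.1] [cite: Rudin1987, Thm. 6.16] -/
theorem exists_kernel_of_offDiagLimitAlong (r : LatticeRep G) {a : ℝ → ℝ} (hapos : ∀ β, 0 < a β)
    (ha0 : Tendsto a atTop (𝓝 0)) (hMB : MomentBounds6 G r a) {sch : SpeciesScheme (YMSpecies G)}
    (hsch : IsLegScheme a sch) {φ : ℕ → ℕ} (hφ : Tendsto φ atTop atTop) {S₁ : SchwingerFamily E4}
    (hS₁ : OffDiagLimitAlong r sch φ S₁) {δ : ℝ} (hδ : 0 < δ) :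
    ∃ K : E4 → ℂ, Measurable K ∧ (∃ B : ℝ, ∀ u, ‖K u‖ ≤ B) ∧
      ∀ F : 𝓢((Fin 2 → E4), ℂ), HasCompactSupport (F : (Fin 2 → E4) → ℂ) →
        tsupport (F : (Fin 2 → E4) → ℂ) ⊆ Separated 2 δ →
          Integrable (fun x : Fin 2 → E4 => K (x 0 - x 1) * F x) ∧ S₁ 2 F = ∫ x : Fin 2 → E4, K (x 0 - x 1) * F x := by
  have hδ3 : 0 < δ / 3 := by positivity
  obtain ⟨B, hB⟩ := hS₁.2.1 2 (δ / 3) hδ3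
  -- a non-negative density constant
  have hdens : ∀ F : 𝓢((Fin 2 → E4), ℂ), HasCompactSupport (F : (Fin 2 → E4) → ℂ) →
      tsupport (F : (Fin 2 → E4) → ℂ) ⊆ Separated 2 (δ / 3) → ‖S₁ 2 F‖ ≤ max B 0 * ∫ x, ‖F x‖ := fun F hFc hFs =>
    (hB F hFc hFs).trans (mul_le_mul_of_nonneg_right (le_max_left _ _) (integral_nonneg fun x => norm_nonneg _))
  have htrans : ∀ (t : E4) (F : 𝓢((Fin 2 → E4), ℂ)), IsOffDiagonal F → S₁ 2 (translateMulti t F) = S₁ 2 F :=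
    fun t F hF => translate_invariant_of_offDiagLimitAlong r hapos ha0 hMB hsch hφ hS₁ 2 t F hF
  obtain ⟨K, hKm, hKb, hK⟩ := exists_kernel_of_translate_invariant (S₁ 2) hδ3 (le_max_right B 0) hdens htrans
  refine ⟨K, hKm, ⟨2 * max B 0, hKb⟩, fun F hFc hFs => hK F hFc ?_⟩
  have h3 : 3 * (δ / 3) = δ := by ring
  rw [h3]
  exact hFs

/-- **The kernel rung in the crux's quantifier prefix** (`SubCurvatureKernel`'s letters, `Theses/F4SubCurvatureDoor.lean` :338ff): for every compact
simple `G`, representation `r`, positive unit map `a → 0` with `MomentBounds6`, admissible leg scheme, subsequence `φ → ∞`, off-diagonal limit point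
`S₁` and separation `δ > 0`, the two-point distribution `S₁ 2` is a bounded measurable kernel of `x₀ − x₁` on compactly supported test functions
supported in `Separated 2 δ`. [cite: OS1973, §2] [cite: Rudin1987, Thm. 6.16] -/
theorem subCurvatureKernel_rung_kernel :
    ∀ (G : Type) [Group G] [TopologicalSpace G] [IsTopologicalGroup G] [CompactSpace G], IsCompactSimpleLieGroup G →
      letI : MeasurableSpace G := borel G; haveI : BorelSpace G := ⟨rfl⟩;
      ∀ (r : LatticeRep G) (a : ℝ → ℝ), (∀ β, 0 < a β) → Tendsto a atTop (nhds 0) → MomentBounds6 G r a →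
        ∀ sch : SpeciesScheme (YMSpecies G), IsLegScheme a sch → ∀ φ : ℕ → ℕ, Tendsto φ atTop atTop →
          ∀ S₁ : SchwingerFamily E4, OffDiagLimitAlong r sch φ S₁ → ∀ δ : ℝ, 0 < δ →
            ∃ K : E4 → ℂ, Measurable K ∧ (∃ B : ℝ, ∀ u, ‖K u‖ ≤ B) ∧
              ∀ F : 𝓢((Fin 2 → E4), ℂ), HasCompactSupport (F : (Fin 2 → E4) → ℂ) →
                tsupport (F : (Fin 2 → E4) → ℂ) ⊆ Separated 2 δ →
                  Integrable (fun x : Fin 2 → E4 => K (x 0 - x 1) * F x) ∧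
                    S₁ 2 F = ∫ x : Fin 2 → E4, K (x 0 - x 1) * F x := by
  intro G _ _ _ _ _
  letI : MeasurableSpace G := borel G
  haveI : BorelSpace G := ⟨rfl⟩
  intro r a hapos ha0 hMB sch hsch φ hφ S₁ hS₁ δ hδ
  exact exists_kernel_of_offDiagLimitAlong r hapos ha0 hMB hsch hφ hS₁ hδ

end Summit.QuantumFields.YangMills.Theorems.F4SubCurvatureDoorSubCurvatureKernelLeg

end
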